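import Mathlib
import Summits.Ventures.HodgeRepro.Tier4.Common.AdelicDefs
import Summits.Ventures.HodgeRepro.Tier4.Common.CongruenceAdeles
import Summits.Ventures.HodgeRepro.Tier4.Common.CompactOpenLevel
import Summits.Ventures.HodgeRepro.Tier4.Line4.LevelCosetCongruence

/-!
# `K(N)` has trivial archimedean component: a rational `κ γ₀ κ'` IS `γ₀` — the `(D)`-shaped sparse-coset
statements are vacuous as typed (t4-L1-p3 g4, finding on LevelCosetCongruence (D) / ArchDistLower (6)(7))
-/

namespace Summit.Ventures.HodgeRepro.Tier4.Line4

open Summit.Ventures.HodgeRepro.Tier4.Common NumberField Matrix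
open scoped NumberField

variable {k : Type} [Field k] [NumberField k]

/-- The archimedean part of a principal adele is the diagonal embedding. -/
theorem infPart_algebraMap (x : k) :
    infPart k (algebraMap k (Ad k) x) = algebraMap k (InfiniteAdeleRing k) x := rfl

/-- The diagonal embedding into the infinite adeles is injective. -/
theorem algebraMap_infiniteAdeleRing_injective :
    Function.Injective (algebraMap k (InfiniteAdeleRing k)) :=
  (algebraMap k (InfiniteAdeleRing k)).injective

/-- A congruence entry which is a principal adele is `0`. -/
theorem eq_zero_of_algebraMap_mem_congrSet {N : ℕ} {x : k} (hx : algebraMap k (Ad k) x ∈ congrSet k N) :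
    x = 0 := by
  have h := hx.1
  rw [infPart_algebraMap] at h
  exact algebraMap_infiniteAdeleRing_injective (by rw [h, map_zero])

variable (W : PlaneData k)

/-- **VACUITY**: for `κ, κ' ∈ K(N)` (archimedean component `1`) and rational `γ₀`, if `κ γ₀ κ'` is rational
then `κ γ₀ κ' = γ₀`. -/
theorem levelK_mul_eq_of_mem_rationalPoints {N : ℕ} {κ κ' γ₀ : GA W} (hκ : κ ∈ levelK W N)
    (hκ' : κ' ∈ levelK W N) (hγ₀ : γ₀ ∈ rationalPoints W) (hint : IsIntegralFin W γ₀)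
    (hγ : κ * γ₀ * κ' ∈ rationalPoints W) : κ * γ₀ * κ' = γ₀ := by
  obtain ⟨m, hm⟩ := exists_rational_mat_of_mem_rationalPoints W hγ
  obtain ⟨m₀, hm₀⟩ := exists_rational_mat_of_mem_rationalPoints W hγ₀
  apply Subtype.ext
  apply Units.ext
  show GA.mat W (κ * γ₀ * κ') = GA.mat W γ₀
  rw [hm, hm₀]
  congr 1
  ext i j
  have hc := mat_sub_mem_congrSet_of_mem_levelK W hκ hκ' hint i j
  rw [hm, hm₀, Matrix.sub_apply, Matrix.map_apply, Matrix.map_apply, ← map_sub] at hc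
  exact sub_eq_zero.mp (eq_zero_of_algebraMap_mem_congrSet hc)

end Summit.Ventures.HodgeRepro.Tier4.Line4
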